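import Literature.AlgebraicGeometry.Resolution.CobordantBlowupExtReesBridge
import Literature.AlgebraicGeometry.Resolution.CobordantBlowupRegularCentre
import Literature.AlgebraicGeometry.Resolution.RegularLocalRingsProofs
import Summits.ResolutionOfSingularities.ResolutionOfSingularities.Theorems.WeightedInvariantHypersurfaceCentreAlgebraize
import Summits.ResolutionOfSingularities.ResolutionOfSingularities.Theorems.WeightedInvariantHypersurfaceLocalGameEFT
import HarnessLib

/-!
# Door assembly H2c″ — [S6] kernel (6a-1): the exceptional parameter `t⁻¹` is PRIME in the game-side carrier

Route `ResolutionOfSingularities/WeightedInvariant`, crux `Theses.WeightedInvariant.HypersurfaceCentreConstruction`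
(stmt-ResolutionOfSingularities-19897), door line `local-engine`, skeleton v3.1, assembly stub **[S6]**
`stub_iotaMax_lt_of_step` (holder res-L1-w43-stub-9 = res-D-brk-1; kernel (6a-1) of the holder's [S6] DECOMPOSITION,
res-type-048).

The game clause `CanonicalGameClause` (tree `…HypersurfaceLocalGameEFT3`) presents a move of the local weighted game at
an e.f.t. position `(S, f)` (`S` a regular local ring) by a FULL regular system of parameters `u : Fin n → S`
(`(u) = 𝔪_S`, `spanFinrank 𝔪_S = n`) with weights `w : Fin n → ℕ`, SOME of them positive and the others `0`
(the centre is `V(uᵢ : wᵢ > 0)`); its carrier is `cobordantAlgebra' u w = extReesAlgebra (weightedMonomialIdeal u w)`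
with exceptional parameter `cobordantT' u w = t⁻¹`.  The exceptional case of [S6] factors the equation of the
hypersurface as `f = (t⁻¹)ᵃ · g₀` with `t⁻¹ ∤ g₀` and identifies `(g₀)` with the `t⁻¹`-saturation of `(f)` at a prime —
which needs `t⁻¹` to be a PRIME element of the carrier.  This file proves exactly that:

* `exists_enum_pos_weights` — the positively weighted indices are enumerated by an injection `σ : Fin n′ → Fin n`;
* `extReesAlgebra_eq_cobordantAlgebra_comp` — **zero weights drop out**: `extReesAlgebra (weightedMonomialIdeal u w) =
  cobordantAlgebra (u ∘ σ) (w ∘ σ)` as subalgebras of `S[t, t⁻¹]` (the holder's reindexing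
  `weightedMonomialIdeal_eq_comp_of_forall_mem_range` composed with the three-algebra bridge
  `extReesAlgebra_weightedMonomialIdeal_eq_cobordantAlgebra` of `CobordantBlowupExtReesBridge`), and
  `exists_ringEquiv_cobordantAlgebra_comp` — the resulting ring identification, the identity on Laurent
  polynomials, carrying `cobordantT' u w` to `cobordantAlgebra.s (u ∘ σ) (w ∘ σ)`;
* `prime_s_comp` — for `S` regular local and `u` a regular system of parameters, `s = t⁻¹` is prime in Włodarczyk's
  `S[t⁻¹, uⱼ t^{wⱼ} : wⱼ > 0]` (the argument of `cobordantAlgebra.prime_s_of_isPrime_span` of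
  `…WeightedThesisPrincipalStrictTransform`, re-run here to keep this file outside the route file's import cone:
  the sub-family `u ∘ σ` of an r.s.p. has linearly independent differentials, hence is weighted quasi-regular
  (`weightedQuasiRegular_of_linearIndependent_toCotangent`) with regular — so integral — quotient `S ⧸ (u ∘ σ)`
  (`isRegularLocalRing_quotient_span_range`, Matsumura 14.2/14.3), and `𝒪_B ⧸ (s) ≅ (S ⧸ (u ∘ σ))[X]`
  (`cobordantAlgebra.nonempty_quotient_span_s_equiv`, Włodarczyk §2.3.9) is a domain);
* `prime_cobordantT'` — **`Prime (cobordantT' u w)`** under `(u) = 𝔪_S`, `spanFinrank 𝔪_S = n` ONLY (the holder's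
  hypothesis `∃ i, 0 < wᵢ` is not needed: with all weights `0` the carrier is `S[t⁻¹]` and `t⁻¹` is still prime);
  `isDomain_cobordantAlgebra'` — the carrier is a domain.

Pure commutative algebra, definition-free, no stub identity; the clauses of H2a⁗ are not used.  Nothing about Hironaka's
problem is claimed.  [OURS · L W4.3]  AI-written; weaker than expert review.

References: J. Włodarczyk, *Functorial resolution by torus actions*, arXiv:2203.03090, Def. 2.3.5, §2.3.9, Rem. 2.3.10,
§4.1 [Wlodarczyk2022]; H. Matsumura, *Commutative Ring Theory*, Thms. 14.2, 14.3 [Matsumura1987].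
-/

noncomputable section

set_option linter.dupNamespace false -- mandated namespace of this single-conjunct summit

open IsLocalRing
open scoped LaurentPolynomial
open Literature.AlgebraicGeometry.Resolution

namespace Summit.ResolutionOfSingularities.ResolutionOfSingularities.Cruxes.HypersurfaceCentreConstruction.LocalEngine

open Summit.ResolutionOfSingularities.ResolutionOfSingularities.Theorems
  (weightedMonomialIdeal_eq_comp_of_forall_mem_range linearIndependent_toCotangent_of_span_eq_of_spanFinrank_eq)

section Reindex

variable {S : Type} [CommRing S] {n : ℕ} (u : Fin n → S) (w : Fin n → ℕ)

/-- The positively weighted indices of a weight vector `w : Fin n → ℕ` are enumerated by an injection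
`σ : Fin n′ → Fin n` (all of whose values have positive weight). [folklore] -/
theorem exists_enum_pos_weights :
    ∃ (n' : ℕ) (σ : Fin n' → Fin n), Function.Injective σ ∧ (∀ i, 0 < w i → i ∈ Set.range σ) ∧
      ∀ j, 0 < w (σ j) := by
  classical
  set s : Finset (Fin n) := Finset.univ.filter (fun i => 0 < w i) with hs
  refine ⟨s.card, fun j => s.orderEmbOfFin rfl j, (s.orderEmbOfFin rfl).injective, fun i hi => ?_, fun j => ?_⟩
  · have hi' : i ∈ (s : Set (Fin n)) := by simp [hs, hi]
    rwa [← Finset.range_orderEmbOfFin s rfl] at hi'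
  · exact (Finset.mem_filter.mp (Finset.orderEmbOfFin_mem s rfl j)).2

/-- **Zero weights drop out of the game-side carrier**: if the injection `σ` hits every positively weighted index, the
extended Rees algebra of the weighted monomial filtration of `(u, w)` IS Włodarczyk's algebra `S[t⁻¹, uⱼ t^{wⱼ}]` of the
sub-family `(u ∘ σ, w ∘ σ)` — as subalgebras of `S[t, t⁻¹]` (Def. 2.3.5 lists only the centre's coordinates; a weight-`0`
parameter contributes `uᵢ t⁰ ∈ S`). [cite: Wlodarczyk2022, Def. 2.3.5] -/
theorem extReesAlgebra_eq_cobordantAlgebra_comp {n' : ℕ} (σ : Fin n' → Fin n) (hσ : Function.Injective σ)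
    (hsurj : ∀ i, 0 < w i → i ∈ Set.range σ) :
    extReesAlgebra (weightedMonomialIdeal u w) = cobordantAlgebra (u ∘ σ) (w ∘ σ) := by
  have h : weightedMonomialIdeal u w = weightedMonomialIdeal (u ∘ σ) (w ∘ σ) :=
    funext (weightedMonomialIdeal_eq_comp_of_forall_mem_range u w σ hσ hsurj)
  rw [h, extReesAlgebra_weightedMonomialIdeal_eq_cobordantAlgebra]

/-- The carrier `cobordantAlgebra' u w` is identified with `cobordantAlgebra (u ∘ σ) (w ∘ σ)` by a ring isomorphism that
is the identity on Laurent polynomials and carries the exceptional parameter `cobordantT' u w = t⁻¹` to Włodarczyk's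
`s = t⁻¹`. [cite: Wlodarczyk2022, Rem. 2.3.10] -/
theorem exists_ringEquiv_cobordantAlgebra_comp {n' : ℕ} (σ : Fin n' → Fin n) (hσ : Function.Injective σ)
    (hsurj : ∀ i, 0 < w i → i ∈ Set.range σ) :
    ∃ e : cobordantAlgebra' u w ≃+* cobordantAlgebra (u ∘ σ) (w ∘ σ),
      (∀ x, ((e x : cobordantAlgebra (u ∘ σ) (w ∘ σ)) : S[T;T⁻¹]) = x) ∧
        e (cobordantT' u w) = cobordantAlgebra.s (u ∘ σ) (w ∘ σ) := by
  -- transport the bridge identification of the SUB-family along `𝒥ₙ(u, w) = 𝒥ₙ(u ∘ σ, w ∘ σ)` (no `rfl` against the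
  -- concrete subalgebras: the kernel would unfold `Algebra.adjoin`)
  have h : weightedMonomialIdeal (u ∘ σ) (w ∘ σ) = weightedMonomialIdeal u w :=
    (funext (weightedMonomialIdeal_eq_comp_of_forall_mem_range u w σ hσ hsurj)).symm
  have hex := exists_ringEquiv_extReesAlgebra_cobordantAlgebra (u ∘ σ) (w ∘ σ)
  rw [h] at hex
  obtain ⟨e, he⟩ := hex
  exact ⟨e, he, Subtype.ext (he _)⟩

/-- The game-side carrier `S[t⁻¹, 𝒥ₙ tⁿ]` of a domain `S` is a domain (a subring of `S[t, t⁻¹]`). [folklore] -/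
theorem isDomain_cobordantAlgebra' [IsDomain S] : IsDomain (cobordantAlgebra' u w) :=
  inferInstance

end Reindex

section Prime

variable {S : Type} [CommRing S] [IsRegularLocalRing S] {n : ℕ} (u : Fin n → S) (w : Fin n → ℕ)

/-- **`s = t⁻¹` is prime in `S[t⁻¹, uⱼ t^{wⱼ} : j]` for a positively weighted SUB-family `u ∘ σ` of a regular system of
parameters `u` of the regular local ring `S`**: the sub-family has linearly independent differentials, so it is weighted
quasi-regular and `S ⧸ (u ∘ σ)` is a regular local ring (Matsumura 14.2), hence a domain (14.3); then
`S[t⁻¹, uⱼ t^{wⱼ}] ⧸ (t⁻¹) ≅ (S ⧸ (u ∘ σ))[X]` (Włodarczyk §2.3.9) is a domain. [cite: Wlodarczyk2022, §2.3.9 and §4.1] -/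
theorem prime_s_comp (hspan : Ideal.span (Set.range u) = maximalIdeal S) (hrk : (maximalIdeal S).spanFinrank = n)
    {n' : ℕ} (σ : Fin n' → Fin n) (hσ : Function.Injective σ) (hpos : ∀ j, 0 < w (σ j)) :
    Prime (cobordantAlgebra.s (u ∘ σ) (w ∘ σ)) := by
  classical
  haveI : IsDomain S := isDomain_of_isRegularLocalRing S
  have hu : ∀ i, u i ∈ maximalIdeal S := fun i => hspan ▸ Ideal.subset_span ⟨i, rfl⟩
  have hu' : ∀ j, (u ∘ σ) j ∈ maximalIdeal S := fun j => hu (σ j)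
  have hli' : LinearIndependent (ResidueField S) fun j => (maximalIdeal S).toCotangent ⟨(u ∘ σ) j, hu' j⟩ :=
    (linearIndependent_toCotangent_of_span_eq_of_spanFinrank_eq u hspan hrk).comp σ hσ
  haveI : IsDomain (S ⧸ Ideal.span (Set.range (u ∘ σ))) := by
    haveI := isRegularLocalRing_quotient_span_range (u ∘ σ) hu' hli'
    exact isDomain_of_isRegularLocalRing _
  have hwqr := weightedQuasiRegular_of_linearIndependent_toCotangent (u ∘ σ) (w ∘ σ) (fun j => hpos j) hu' hli'
  -- `𝒪_B ⧸ (s) ≅ (S ⧸ (u ∘ σ))[X]` is a domain, so `(s)` is a prime ideal and `s ≠ 0` is a prime element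
  obtain ⟨e⟩ := cobordantAlgebra.nonempty_quotient_span_s_equiv (u ∘ σ) (w ∘ σ) (fun j => hpos j) hwqr
  haveI : IsDomain (cobordantAlgebra (u ∘ σ) (w ∘ σ) ⧸ Ideal.span {cobordantAlgebra.s (u ∘ σ) (w ∘ σ)}) :=
    e.toMulEquiv.isDomain
  rw [← Ideal.span_singleton_prime
    (nonZeroDivisors.ne_zero (cobordantAlgebra.s_mem_nonZeroDivisors (u ∘ σ) (w ∘ σ)))]
  exact (Ideal.Quotient.isDomain_iff_prime _).mp inferInstance

/-- **(6a-1) The exceptional parameter `t⁻¹` is a prime element of the game-side carrier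
`cobordantAlgebra' u w = S[t⁻¹, 𝒥ₙ(u, w) tⁿ]`** for `S` a regular local ring, `u` a regular system of parameters
(`(u) = 𝔪_S`, `spanFinrank 𝔪_S = n`) and ARBITRARY weights `w : Fin n → ℕ` (zeros allowed): transport of `prime_s_comp`
along `exists_ringEquiv_cobordantAlgebra_comp` for an enumeration of the positively weighted indices.
[cite: Wlodarczyk2022, §2.3.9 and §4.1] -/
theorem prime_cobordantT' (hspan : Ideal.span (Set.range u) = maximalIdeal S)
    (hrk : (maximalIdeal S).spanFinrank = n) : Prime (cobordantT' u w) := by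
  obtain ⟨n', σ, hσ, hsurj, hpos⟩ := exists_enum_pos_weights w
  obtain ⟨e, -, he⟩ := exists_ringEquiv_cobordantAlgebra_comp u w σ hσ hsurj
  have h := prime_s_comp u w hspan hrk σ hσ hpos
  rw [← he] at h
  exact (MulEquiv.prime_iff e).mp h

/-- (6a-1) with the holder's binder list (the positivity hypothesis is idle). [cite: Wlodarczyk2022, §2.3.9 and §4.1] -/
theorem prime_cobordantT'_of_exists_pos (hspan : Ideal.span (Set.range u) = maximalIdeal S)
    (hrk : (maximalIdeal S).spanFinrank = n) (_hpos : ∃ i, 0 < w i) : Prime (cobordantT' u w) :=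
  prime_cobordantT' u w hspan hrk

/-- `t⁻¹ ≠ 0` in the carrier and the ideal `(t⁻¹)` is prime. [cite: Wlodarczyk2022, §2.3.9 and §4.1] -/
theorem span_cobordantT'_isPrime (hspan : Ideal.span (Set.range u) = maximalIdeal S)
    (hrk : (maximalIdeal S).spanFinrank = n) : (Ideal.span {cobordantT' u w}).IsPrime := by
  have h := prime_cobordantT' u w hspan hrk
  exact (Ideal.span_singleton_prime h.ne_zero).mpr h

end Prime

/-! ## rev 2 (append-only) — the EXCEPTIONAL-CASE FACTORISATION `f = (t⁻¹)ᵃ · g₀`, `t⁻¹ ∤ g₀`, and the affine strict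
transform `σˢ((f)) = (g₀)` on the game-side carrier

The game clause's (drop) binders are `(a : ℕ) (g : cobordantAlgebra' u w)` with `algebraMap S _ f = cobordantT' u w ^ a * g`
and `¬ cobordantT' u w ∣ g`; this section PRODUCES them for every `f ≠ 0` (finite multiplicity of the prime `t⁻¹` in the
Noetherian domain `S[t⁻¹, 𝒥ₙ tⁿ]`) and identifies the affine strict transform of `(f)` with `(g₀)` (Włodarczyk 3.3.12). -/

section Factor

variable {S : Type} [CommRing S] {n : ℕ} (u : Fin n → S) (w : Fin n → ℕ)

/-- `S → S[t⁻¹, 𝒥ₙ tⁿ]` is injective (`a ↦ a t⁰` into `S[t, t⁻¹]`). [folklore] -/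
theorem algebraMap_cobordantAlgebra'_injective : Function.Injective (algebraMap S (cobordantAlgebra' u w)) := by
  intro a b h
  have h' : (LaurentPolynomial.C a : S[T;T⁻¹]) = LaurentPolynomial.C b := by
    have hab := congrArg (fun x : cobordantAlgebra' u w => (x : S[T;T⁻¹])) h
    simpa only [Subalgebra.coe_algebraMap, ← LaurentPolynomial.C_eq_algebraMap] using hab
  rw [← Polynomial.toLaurent_C, ← Polynomial.toLaurent_C] at h'
  exact Polynomial.C_injective (Polynomial.toLaurent_injective h')

/-- `f ≠ 0 ⇒ f ≠ 0` in the carrier. [folklore] -/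
theorem algebraMap_cobordantAlgebra'_ne_zero {f : S} (hf : f ≠ 0) : algebraMap S (cobordantAlgebra' u w) f ≠ 0 :=
  fun h => hf (algebraMap_cobordantAlgebra'_injective u w (by rw [h, map_zero]))

/-- The game-side carrier `S[t⁻¹, 𝒥ₙ(u, w) tⁿ]` of a Noetherian ring is Noetherian (it is `S[t⁻¹, uᵢ t^{wᵢ}]`, a quotient of
a polynomial ring in `n + 1` variables over `S`). [cite: Wlodarczyk2022, §2.3.9] -/
theorem isNoetherianRing_cobordantAlgebra' [IsNoetherianRing S] : IsNoetherianRing (cobordantAlgebra' u w) := by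
  show IsNoetherianRing ↥(extReesAlgebra (weightedMonomialIdeal u w))
  rw [extReesAlgebra_weightedMonomialIdeal_eq_cobordantAlgebra]
  exact cobordantAlgebra.isNoetherianRing u w

/-- **The exceptional-case factorisation**: for `S` regular local, `u` a regular system of parameters, arbitrary weights
and `f ≠ 0`, `f = (t⁻¹)ᵃ · g₀` in `S[t⁻¹, 𝒥ₙ tⁿ]` with `t⁻¹ ∤ g₀` (`a` = the multiplicity of the prime `t⁻¹` in `f`,
finite in the Noetherian domain `S[t⁻¹, 𝒥ₙ tⁿ]`) — the binders `(a, g)` of the game clause's (drop).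
[cite: Wlodarczyk2022, 3.3.12] -/
theorem exists_eq_cobordantT'_pow_mul_not_dvd [IsRegularLocalRing S]
    (hspan : Ideal.span (Set.range u) = maximalIdeal S) (hrk : (maximalIdeal S).spanFinrank = n)
    {f : S} (hf : f ≠ 0) :
    ∃ (a : ℕ) (g₀ : cobordantAlgebra' u w),
      algebraMap S (cobordantAlgebra' u w) f = cobordantT' u w ^ a * g₀ ∧ ¬ cobordantT' u w ∣ g₀ := by
  haveI : IsDomain S := isDomain_of_isRegularLocalRing S
  haveI : IsDomain (cobordantAlgebra' u w) := isDomain_cobordantAlgebra' u w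
  haveI : IsNoetherianRing (cobordantAlgebra' u w) := isNoetherianRing_cobordantAlgebra' u w
  obtain ⟨g₀, hfg, hndvd⟩ := (FiniteMultiplicity.of_prime_left (prime_cobordantT' u w hspan hrk)
    (algebraMap_cobordantAlgebra'_ne_zero u w hf)).exists_eq_pow_mul_and_not_dvd
  exact ⟨_, g₀, hfg, hndvd⟩

/-- In a commutative domain: `s` prime, `s ∤ g₀`, `g₀ ∣ sᵐ · x` ⇒ `g₀ ∣ x`. [folklore] -/
theorem dvd_of_not_dvd_of_dvd_prime_pow_mul {B : Type} [CommRing B] [IsDomain B] {s g₀ : B} (hs : Prime s)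
    (hsg : ¬ s ∣ g₀) : ∀ (m : ℕ) (x : B), g₀ ∣ s ^ m * x → g₀ ∣ x := by
  intro m
  induction m with
  | zero => intro x hx; simpa using hx
  | succ m ih =>
    intro x hx
    obtain ⟨c, hc⟩ := hx
    -- `s ∣ g₀ c = s^{m+1} x`, `s ∤ g₀` ⇒ `c = s c'`
    have hsc : s ∣ g₀ * c := ⟨s ^ m * x, by rw [← hc, pow_succ]; ring⟩
    rcases hs.dvd_or_dvd hsc with h | ⟨c', rfl⟩
    · exact absurd h hsg
    · refine ih x ⟨c', mul_left_cancel₀ hs.ne_zero ?_⟩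
      have : s * (s ^ m * x) = s * (g₀ * c') := by
        rw [← mul_assoc, ← pow_succ', hc]; ring
      exact this

/-- **The affine strict transform of a principal ideal is principal**: if `f = (t⁻¹)ᵃ · g₀` with `t⁻¹` prime and
`t⁻¹ ∤ g₀`, then `σˢ((f)) = ((f) : (t⁻¹)^∞) = (g₀)` in `S[t⁻¹, 𝒥ₙ tⁿ]` (`S` a domain). [cite: Wlodarczyk2022, 3.3.12] -/
theorem strictTransform_span_singleton_eq_of_factor [IsDomain S] (hT : Prime (cobordantT' u w)) {f : S} {a : ℕ}
    {g₀ : cobordantAlgebra' u w} (hf : algebraMap S (cobordantAlgebra' u w) f = cobordantT' u w ^ a * g₀)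
    (hndvd : ¬ cobordantT' u w ∣ g₀) :
    extReesAlgebra.strictTransform (weightedMonomialIdeal u w) (Ideal.span {f}) = Ideal.span {g₀} := by
  haveI : IsDomain (cobordantAlgebra' u w) := isDomain_cobordantAlgebra' u w
  apply le_antisymm
  · intro g hg
    obtain ⟨m, hm⟩ := (extReesAlgebra.mem_strictTransform_iff _).mp hg
    rw [Ideal.map_span, Set.image_singleton, Ideal.mem_span_singleton] at hm
    rw [Ideal.mem_span_singleton]
    refine dvd_of_not_dvd_of_dvd_prime_pow_mul hT hndvd m g ?_
    have hfg : g₀ ∣ algebraMap S (cobordantAlgebra' u w) f := ⟨cobordantT' u w ^ a, by rw [hf, mul_comm]⟩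
    exact hfg.trans hm
  · rw [Ideal.span_singleton_le_iff_mem, extReesAlgebra.mem_strictTransform_iff]
    refine ⟨a, ?_⟩
    rw [Ideal.map_span, Set.image_singleton, hf]
    exact Ideal.subset_span rfl

/-- **Exceptional-case package for [S6]**: `S` regular local, `u` an r.s.p., arbitrary weights, `f ≠ 0` ⇒ there are
`a` and `g₀` with `f = (t⁻¹)ᵃ g₀`, `t⁻¹ ∤ g₀` and `σˢ((f)) = (g₀)`. [cite: Wlodarczyk2022, 3.3.12] -/
theorem exists_factor_strictTransform_eq [IsRegularLocalRing S]
    (hspan : Ideal.span (Set.range u) = maximalIdeal S) (hrk : (maximalIdeal S).spanFinrank = n)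
    {f : S} (hf : f ≠ 0) :
    ∃ (a : ℕ) (g₀ : cobordantAlgebra' u w),
      algebraMap S (cobordantAlgebra' u w) f = cobordantT' u w ^ a * g₀ ∧ ¬ cobordantT' u w ∣ g₀ ∧
        extReesAlgebra.strictTransform (weightedMonomialIdeal u w) (Ideal.span {f}) = Ideal.span {g₀} := by
  haveI : IsDomain S := isDomain_of_isRegularLocalRing S
  obtain ⟨a, g₀, hfg, hndvd⟩ := exists_eq_cobordantT'_pow_mul_not_dvd u w hspan hrk hf
  exact ⟨a, g₀, hfg, hndvd,
    strictTransform_span_singleton_eq_of_factor u w (prime_cobordantT' u w hspan hrk) hfg hndvd⟩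

end Factor

end Summit.ResolutionOfSingularities.ResolutionOfSingularities.Cruxes.HypersurfaceCentreConstruction.LocalEngine

end
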